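import Literature.NumberTheory.Automorphic.UnitaryGroupBorelInduction
import Literature.NumberTheory.Automorphic.ParabolicInductionAdmissibleProofs
import Literature.RepresentationTheory.IrreducibleTwistTransport
import HarnessLib

/-!
# Stub E3-T4a₁ of `Cruxes/H413/Lines/F0_LocalAPackets.lean` (edition 3, §6): CONSTITUENT TRANSPORT along a topological-group
# isomorphism — `⟦c ∘ e⟧` is a constituent of `ρ ∘ e` iff `c` is a constituent of `ρ`

Cell hodgecm-mathlib, FLOOR 0, crux item H413 = stmt-HodgeConjecture-24833, sub-programme P3b (local A-packets), line
`Cruxes/H413/Lines/F0_LocalAPackets.lean` edition 3 §6 (NON-SPLIT finite places, E2-T4a; planner F0P3b-plan (g5), draft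
`F0/P3b/sec6_nonsplit.draft.F0P3b-plan-g5.lean` 8f23ebc4007c5b6e), registered stub `stub_ConstituentTransport : StubConstituentTransport`
(brief B7, A-p03 (g17)).  Namespace `Summit.HodgeConjecture.HodgeConjecture.Cruxes.H413.F0P3bStubConstituentTransport`.  PROOF lane:
THEOREMS ONLY — no `def`, no instance, no notation, no named fact, no `sorry`; never imports `Cruxes/…/Lines/…` (s347 ∕ s380b).  The two
line-local definitions `pullbackIrrep e r := ⟨r.V, r.ρ ∘ e, …⟩` and `pullbackClass e := Quotient.map (pullbackIrrep e) …` of the line are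
NOT restated as constants: every statement below carries them `δ`-UNFOLDED (the structure literal and the `Quotient.map` term written out),
so the registered stub closes BY NAME through definitional unfolding of the line's own copies (fold certified by paste over the planner's
draft: `theorem stub_ConstituentTransport : StubConstituentTransport := stubConstituentTransport_holds` elaborates, 0 `sorry`).
HC_CM is proved only modulo the printed citations until rung 0 closes.

WHAT.  For `e : G′ ≃ₜ* G`, a representation `ρ` of `G` on `V` and a class `c ∈ Irr(G)` (★ `IrrClass`), the pull-back class
`⟦r ∘ e⟧ ∈ Irr(G′)` is a CONSTITUENT (★ `IrrClass.IsConstituentOf`: isomorphic to a subquotient `N₁ ⁄ N₂` of `G`-stable subspaces) of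
`ρ ∘ e` iff `c` is a constituent of `ρ` — the junction every inner-form statement of the line uses («`π_v` is a constituent of
`i_G(χ_{ξ_v})` read on `U(H′)(L⁺_v)` along `U(H′)(L⁺_v) ≃ₜ* U(Φ₃)(L⁺_v)`», [Rogawski1990, §12.2 p. 173]).

HOW.  (⇐) `isConstituentOf_pullback`: the `G`-stable subspaces `N₂ ≤ N₁` of `ρ` ARE `G′`-stable subspaces of `ρ ∘ e`
(`(ρ ∘ e)(g′) = ρ(e g′)`), the subquotient representation of `ρ ∘ e` on `N₁ ⁄ N₂` is DEFINITIONALLY `(N₁ ⁄ N₂) ∘ e`, and a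
`G`-isomorphism `φ : r ≅ N₁ ⁄ N₂` is the `G′`-isomorphism `r ∘ e ≅ (N₁ ⁄ N₂) ∘ e` with the same linear map (`φ.isIntertwining′ (e g′)`).
(⇒) is (⇐) for `e⁻¹` applied to `ρ ∘ e` and `⟦c ∘ e⟧`, read through `⟦(c ∘ e) ∘ e⁻¹⟧ = c` (`pullback_symm_pullback`: identity linear
map, `ρ(e(e⁻¹ g)) = ρ(g)`) and `(ρ ∘ e) ∘ e⁻¹ = ρ` (`comp_coe_comp_coe_symm`).

## References
* [Rogawski1990] J. Rogawski, *Automorphic Representations of Unitary Groups in Three Variables*, Ann. of Math. Stud. 123 (1990),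
  §12.2 p. 173 (constituents of `i_G(χ)`), §13.1.
* [BushnellHenniart2006] C. Bushnell, G. Henniart, *The Local Langlands Conjecture for GL(2)*, Grundlehren 335 (2006), §1.1–1.2, §2
  (`Irr(G)`, subquotients).
-/

set_option autoImplicit false
set_option linter.dupNamespace false

noncomputable section

namespace Summit.HodgeConjecture.HodgeConjecture.Cruxes.H413.F0P3bStubConstituentTransport

open Literature.NumberTheory Literature.NumberTheory.Automorphic

universe u

/-! ## §1 Pull-back of irreducibles and of classes along `e : G′ ≃ₜ* G` — the line's `pullbackIrrep` ∕ `pullbackClass`, UNFOLDED -/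

/-- Pull-backs of isomorphic irreducibles along `e` are isomorphic (same linear isomorphism) — the well-definedness proof of the
line's `pullbackClass`, for the UNFOLDED structure literal `⟨r.V, r.ρ ∘ e, _, _⟩` (= the line's `pullbackIrrep e r`).
[cite: BushnellHenniart2006, §1.1] -/
theorem pullback_equiv {G G' : Type u} [Group G] [TopologicalSpace G] [Group G'] [TopologicalSpace G']
    (e : G' ≃ₜ* G) (r₁ r₂ : SmoothIrrep G) (h : r₁ ≈ r₂) :
    (⟨r₁.V, r₁.ρ.comp (e : G' →* G), r₁.isIrreducible.comp_of_surjective _ e.surjective, r₁.isSmooth.comp _ e.continuous⟩ :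
        SmoothIrrep G') ≈
      ⟨r₂.V, r₂.ρ.comp (e : G' →* G), r₂.isIrreducible.comp_of_surjective _ e.surjective, r₂.isSmooth.comp _ e.continuous⟩ := by
  obtain ⟨φ⟩ := (SmoothIrrep.equiv_iff r₁ r₂).1 h
  exact (SmoothIrrep.equiv_iff _ _).2 ⟨Representation.Equiv.mk φ.toLinearEquiv fun g' => φ.isIntertwining' (e g')⟩

/-! ## §2 Bookkeeping: `e⁻¹` undoes `e` on classes and on representations -/

/-- `⟦(r ∘ e) ∘ e⁻¹⟧ = ⟦r⟧` in `Irr(G)` (the same space and operators `ρ(e(e⁻¹ g)) = ρ(g)`; identity linear isomorphism) — the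
line's `pullbackClass e.symm (pullbackClass e c) = c`, UNFOLDED. [cite: BushnellHenniart2006, §1.1] -/
theorem pullback_symm_pullback {G G' : Type u} [Group G] [TopologicalSpace G] [Group G'] [TopologicalSpace G']
    (e : G' ≃ₜ* G) (c : IrrClass G) :
    (Quotient.map
        (fun r : SmoothIrrep G' => (⟨r.V, r.ρ.comp (e.symm : G →* G'), r.isIrreducible.comp_of_surjective _ e.symm.surjective,
          r.isSmooth.comp _ e.symm.continuous⟩ : SmoothIrrep G))
        (fun r₁ r₂ h => pullback_equiv e.symm r₁ r₂ h)
      (Quotient.map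
        (fun r : SmoothIrrep G => (⟨r.V, r.ρ.comp (e : G' →* G), r.isIrreducible.comp_of_surjective _ e.surjective,
          r.isSmooth.comp _ e.continuous⟩ : SmoothIrrep G'))
        (fun r₁ r₂ h => pullback_equiv e r₁ r₂ h) c : IrrClass G') : IrrClass G) = c := by
  induction c using Quotient.inductionOn with
  | h r =>
    refine Quotient.sound ⟨Representation.Equiv.mk (LinearEquiv.refl ℂ r.V) fun g => ?_⟩
    refine LinearMap.ext fun v => ?_
    change r.ρ (e (e.symm g)) v = r.ρ g v
    rw [ContinuousMulEquiv.apply_symm_apply]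

/-- `(ρ ∘ e) ∘ e⁻¹ = ρ`. [folklore] -/
theorem comp_coe_comp_coe_symm {G G' : Type u} [Group G] [TopologicalSpace G] [Group G'] [TopologicalSpace G']
    (e : G' ≃ₜ* G) {V : Type*} [AddCommGroup V] [Module ℂ V] (ρ : Representation ℂ G V) :
    (ρ.comp (e : G' →* G)).comp (e.symm : G →* G') = ρ := by
  refine MonoidHom.ext fun g => ?_
  change ρ (e (e.symm g)) = ρ g
  rw [ContinuousMulEquiv.apply_symm_apply]

/-! ## §3 Constituents pull back along `e` -/

/-- **(⇐) Constituents pull back**: if `c` is a constituent of `ρ` then `⟦c ∘ e⟧` (the line's `pullbackClass e c`, unfolded) is a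
constituent of `ρ ∘ e` — the `G`-stable subspaces `N₂ ≤ N₁` are `G′`-stable for `ρ ∘ e`, the subquotient representation on
`N₁ ⁄ N₂` is definitionally `(N₁ ⁄ N₂) ∘ e`, and the isomorphism `r ≅ N₁ ⁄ N₂` intertwines `r ∘ e` with it.
[cite: Rogawski1990, §12.2 p. 173] -/
theorem isConstituentOf_pullback {G G' : Type u} [Group G] [TopologicalSpace G] [Group G'] [TopologicalSpace G']
    (e : G' ≃ₜ* G) {V : Type*} [AddCommGroup V] [Module ℂ V] (ρ : Representation ℂ G V) (c : IrrClass G)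
    (h : c.IsConstituentOf ρ) :
    IrrClass.IsConstituentOf
      (Quotient.map
        (fun r : SmoothIrrep G => (⟨r.V, r.ρ.comp (e : G' →* G), r.isIrreducible.comp_of_surjective _ e.surjective,
          r.isSmooth.comp _ e.continuous⟩ : SmoothIrrep G'))
        (fun r₁ r₂ h => pullback_equiv e r₁ r₂ h) c : IrrClass G') (ρ.comp (e : G' →* G)) := by
  obtain ⟨r₀, hr₀, N₁, N₂, hle, ⟨φ⟩⟩ := h
  subst hr₀
  refine ⟨⟨r₀.V, r₀.ρ.comp (e : G' →* G), r₀.isIrreducible.comp_of_surjective _ e.surjective, r₀.isSmooth.comp _ e.continuous⟩,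
    rfl, ⟨N₁.toSubmodule, fun g' _ hv => N₁.apply_mem_toSubmodule (e g') hv⟩,
    ⟨N₂.toSubmodule, fun g' _ hv => N₂.apply_mem_toSubmodule (e g') hv⟩, fun v hv => hle hv, ⟨?_⟩⟩
  exact Representation.Equiv.mk φ.toLinearEquiv fun g' => φ.isIntertwining' (e g')

/-! ## §4 The stub -/

/-- **Stub E3-T4a₁ — CONSTITUENT TRANSPORT along a topological-group isomorphism**: the registered body of `StubConstituentTransport`
with the line-local `pullbackClass e c` (`:= Quotient.map (pullbackIrrep e) … c`, `pullbackIrrep e r := ⟨r.V, r.ρ ∘ e, _, _⟩`)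
`δ`-UNFOLDED, so that `stub_ConstituentTransport := stubConstituentTransport_holds` closes the stub by definitional unfolding: for
`e : G′ ≃ₜ* G`, a representation `ρ` of `G` and a class `c ∈ Irr(G)`, `⟦c ∘ e⟧` is a constituent of `ρ ∘ e` iff `c` is a constituent
of `ρ`.  (⇐) is §3; (⇒) is §3 for `e⁻¹` at `ρ ∘ e` and `⟦c ∘ e⟧`, read through §2. [cite: Rogawski1990, §12.2 p. 173]
[cite: BushnellHenniart2006, §2] -/
theorem stubConstituentTransport_holds :
    ∀ (G G' : Type) [Group G] [TopologicalSpace G] [Group G'] [TopologicalSpace G'] (e : G' ≃ₜ* G)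
    (V : Type) [AddCommGroup V] [Module ℂ V] (ρ : Representation ℂ G V) (c : IrrClass G),
    IrrClass.IsConstituentOf
      (Quotient.map
        (fun r : SmoothIrrep G => (⟨r.V, r.ρ.comp (e : G' →* G), r.isIrreducible.comp_of_surjective _ e.surjective,
          r.isSmooth.comp _ e.continuous⟩ : SmoothIrrep G'))
        (fun r₁ r₂ h => pullback_equiv e r₁ r₂ h) c : IrrClass G') (ρ.comp (e : G' →* G)) ↔ c.IsConstituentOf ρ := by
  intro G G' _ _ _ _ e V _ _ ρ c
  refine ⟨fun h => ?_, isConstituentOf_pullback e ρ c⟩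
  have h' := isConstituentOf_pullback e.symm (ρ.comp (e : G' →* G)) _ h
  rwa [pullback_symm_pullback, comp_coe_comp_coe_symm] at h'

end Summit.HodgeConjecture.HodgeConjecture.Cruxes.H413.F0P3bStubConstituentTransport

end
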